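import Literature.MathematicalPhysics.KineticTheory.HardSphereEuler
import Literature.MathematicalPhysics.KineticTheory.BackwardCluster
import Literature.MathematicalPhysics.KineticTheory.HardSphereEulerProofs
import Literature.MathematicalPhysics.KineticTheory.CollisionFluxUpperBound
import Literature.MathematicalPhysics.KineticTheory.CollisionFluxMeanBound
import Literature.MathematicalPhysics.KineticTheory.HardSphereMeanCollisionCount
import Summits.AtomisticToContinuum.HydrodynamicLimit.Theorems.JParityClosureCollisionTightnessSweptTube
import Summits.AtomisticToContinuum.HydrodynamicLimit.Theorems.JParityClosureCollisionTightnessTorusGibbs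
import Summits.AtomisticToContinuum.HydrodynamicLimit.Theorems.JParityClosureOddContactSymmetryGibbsInvariance
import HarnessLib

/-!
# Stub `stub_pairSlabContact` of the line `Sketch` (log-window-tagged-tail) for the crux
`RelayRaceLocality.GibbsLightCone` (stmt-AtomisticToContinuum-12501)

Registered stub of the lead prover's skeleton (`Cruxes/GibbsLightCone/Lines/Sketch.lean`, revision 13):
the FIRST-MOMENT ANCHOR (the instance `n = 1` of the slab-contact necklace bound `X″`).  For `N + 1`
hard spheres of diameter `ε_N = hsDiameter σ N` on `𝕋³` under the homogeneous Gibbs law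
`G_N = localGibbsLaw σ a 0 θ N Φ` (constant activity `a > 0`, zero drift, constant temperature
`θ > 0`, `0 < σ ≤ 1/2`), a prescribed pair `i ≠ j`, a time `t` and a slab length `Δ > 0`:

`G_N {∃ u ∈ [t, t + Δ], {i, j} ∈ contactPairSet (Φ_u z)} ≤ 40 √3 · ε_N² √θ Δ`.

Proof (Cercignani–Illner–Pulvirenti 1994 App. 4.A, the collision flux in Markov form):

* `measure_good_inter_pairContact_le` — the slab `[0, Δ]` on the good set: a contact of the pair
  `{i, j}` at a time `u ∈ [0, Δ]` of a good orbit is a collision time at which the ordered pair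
  `(i, j)` is at contact (`Torus.euclidDist_comm` for the other order), so the collision sum of the
  mark `𝟙_{(i', j') = (i, j)}` over `[0, Δ]` is `≥ 1`; the window bound
  `measure_collisionSum_ge_le_liminf` (pathwise grid bound, Fatou, stationarity
  `measurePreserving_flow_localGibbsLaw_const`, Markov) with the one-window events of
  `exists_windowEvent_of_pairBound` (swept tubes `exists_sweptTube`, minimal-image lift inequality
  `volume_setOf_exists_reprSym_add_latticeVec_mem_le`, Ruelle pair constant `5` of
  `posGibbs_pairEvent_le_five`, valid for every `σ ≤ 1/2`, `N ≥ 1` — and `N = 0` has no pair) bounds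
  the probability by `liminf_M M · 5 · 4 ε² (Δ/M) · ∫ ‖w − v‖ dγdγ = 20 ε² Δ · ∫ ‖w − v‖`, and the
  Gaussian flux integral is `≤ 2 √(3θ)` (`lintegral_norm_sub_prod_gaussMeasure_le`);
* `stub_pairSlabContact` — a general slab `[t, t + Δ]` is transported to `[0, Δ]` by the group law
  of the flow on the good set (`Φ_u z = Φ_{u−t} (Φ_t z)`), the invariance `(Φ_t)_# G_N = G_N` and
  `G_N(goodᶜ) = 0`; no measurability of the event is needed (`Measure.le_map_apply`).

References: C. Cercignani, R. Illner, M. Pulvirenti, *The Mathematical Theory of Dilute Gases*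
(1994), App. 4.A; I. Gallagher, L. Saint-Raymond, B. Texier, *From Newton to Boltzmann* (2013),
Prop. 4.1.1.
-/

noncomputable section

namespace Summit.AtomisticToContinuum.HydrodynamicLimit.Theorems.LogWindowTaggedTail

open Literature.MathematicalPhysics.KineticTheory Literature.Analysis.FluidPDE MeasureTheory Filter Set
open Literature.Analysis.FunctionSpaces

open scoped ENNReal

/-- **Pair slab-contact bound on the good set, slab `[0, Δ]`.** For `a, θ > 0`, `0 < σ ≤ 1/2`, a
hard-sphere flow `Φ` of `N + 1` spheres of diameter `ε_N = hsDiameter σ N` on `𝕋³`, a pair `i ≠ j` and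
`Δ > 0`, the `G_N`-probability that a GOOD orbit has the pair `{i, j}` in contact at some time of
`[0, Δ]` is at most `40 √3 · ε_N² √θ Δ` (collision-flux bound in Markov form with the pair-indicator
mark; Cercignani–Illner–Pulvirenti 1994 App. 4.A). [folklore] -/
theorem measure_good_inter_pairContact_le {a θ σ : ℝ} (ha : 0 < a) (hθ : 0 < θ) (hσ : 0 < σ)
    (hσ2 : σ ≤ 1 / 2) {N : ℕ}
    (Φ : HardSphereFlow (Torus.geometry (Fin 3)) (hsDiameter σ N) (N + 1)) {i j : Fin (N + 1)}
    (hij : i ≠ j) {Δ : ℝ} (hΔ : 0 < Δ) :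
    localGibbsLaw σ (fun _ => a) (fun _ => 0) (fun _ => θ) N Φ
        {z | z ∈ Φ.good ∧ ∃ u ∈ Icc 0 Δ,
          s(i, j) ∈ contactPairSet (Torus.geometry (Fin 3)) (hsDiameter σ N) (Φ.flow u z)} ≤
      ENNReal.ofReal (40 * Real.sqrt 3 * (hsDiameter σ N ^ 2 * Real.sqrt θ * Δ)) := by
  classical
  -- `N = 0` has no pair of distinct labels
  have hN : 1 ≤ N := by
    rcases Nat.eq_zero_or_pos N with h0 | h0
    · exfalso
      subst h0
      exact hij (Fin.ext (by have hi := i.isLt; have hj := j.isLt; omega))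
    · exact h0
  have hε : 0 < hsDiameter σ N := hsDiameter_pos hσ N
  set P := localGibbsLaw σ (fun _ => a) (fun _ => (0 : V3)) (fun _ => θ) N Φ with hPdef
  -- stationarity of the homogeneous Gibbs law
  have hstat : ∀ t : ℝ, MeasurePreserving (Φ.flow t) P P := fun t =>
    measurePreserving_flow_localGibbsLaw_const σ a θ 0 N Φ t
  -- the minimal-image lift inequality
  have hlift : ∀ B : Set V3, MeasurableSet B →
      volume {x : T3 | ∃ k : Fin 3 → ℤ, Torus.reprSym x + Torus.latticeVec k ∈ B} ≤ volume B :=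
    fun B hB => by simpa only [sub_zero] using volume_setOf_exists_reprSym_add_latticeVec_mem_le 0 hB
  -- the Gaussian flux integral
  set I : ℝ≥0∞ := ∫⁻ p, ENNReal.ofReal ‖p.2 - p.1‖
    ∂((gaussMeasure (0 : V3) θ).prod (gaussMeasure (0 : V3) θ)) with hIdef
  have hI : I ≤ ENNReal.ofReal (2 * Real.sqrt (3 * θ)) := lintegral_norm_sub_prod_gaussMeasure_le 0 hθ
  -- the one-window events of every ordered pair, for every mesh `Δ / M`
  have hev : ∀ (M : ℕ) (i' j' : Fin (N + 1)), ∃ E : Set (Config (N + 1) (Fin 3) T3),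
      MeasurableSet E ∧
      (i' ≠ j' → ∀ w ∈ hardSphereDomain (Torus.geometry (Fin 3)) (N + 1) (hsDiameter σ N),
        ∀ t ∈ Icc 0 (Δ / M),
        ‖(Torus.geometry (Fin 3)).sepVec ((freeFlight (Torus.geometry (Fin 3)) (-t) w i').1)
          ((freeFlight (Torus.geometry (Fin 3)) (-t) w j').1)‖ = hsDiameter σ N → w ∈ E) ∧
      (i' ≠ j' → ∫⁻ w, E.indicator (fun _ => (1 : ℝ≥0∞)) w ∂P ≤
        5 * ENNReal.ofReal (4 * hsDiameter σ N ^ 2 * (Δ / M)) * I) := by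
    intro M i' j'
    by_cases hij' : i' ≠ j'
    · have hh : 0 ≤ Δ / M := div_nonneg hΔ.le (Nat.cast_nonneg M)
      obtain ⟨S, hSm, hSvol, hS⟩ := exists_sweptTube hε hh
      obtain ⟨E, hEm, hEc, hEb⟩ := exists_windowEvent_of_pairBound hσ2 ha hθ (0 : V3) hh hij'
        (fun T hT => posGibbs_pairEvent_le_five hσ.le hσ2 hN hij' hT) hSm hSvol hS hlift
      refine ⟨E, hEm, fun _ => hEc, fun _ => ?_⟩
      have h1 := hEb Φ (fun _ => 1) measurable_const
      simp only [mul_one] at h1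
      exact h1
    · exact ⟨∅, MeasurableSet.empty, fun h => absurd h hij', fun h => absurd h hij'⟩
  choose E hEm hEc hEb using hev
  -- the mark: the indicator of the ordered pair `(i, j)` (a constant function of the configuration)
  set F : Config (N + 1) (Fin 3) T3 → Fin (N + 1) → Fin (N + 1) → ℝ≥0∞ :=
    fun _ i' j' => if i' = i ∧ j' = j then 1 else 0 with hFdef
  have hFm : ∀ (M : ℕ) (i' j' : Fin (N + 1)),
      Measurable fun w : Config (N + 1) (Fin 3) T3 => F w i' j' :=
    fun _ i' j' => (measurable_const : Measurable fun _ : Config (N + 1) (Fin 3) T3 =>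
      (if i' = i ∧ j' = j then (1 : ℝ≥0∞) else 0))
  have hFt : ∀ (M : ℕ) (i' j' : Fin (N + 1)), i' ≠ j' →
      ∀ w ∈ hardSphereDomain (Torus.geometry (Fin 3)) (N + 1) (hsDiameter σ N), ∀ t ∈ Icc 0 (Δ / M),
        ‖(Torus.geometry (Fin 3)).sepVec ((freeFlight (Torus.geometry (Fin 3)) (-t) w i').1)
          ((freeFlight (Torus.geometry (Fin 3)) (-t) w j').1)‖ = hsDiameter σ N →
        F (freeFlight (Torus.geometry (Fin 3)) (-t) w) i' j' ≤ F w i' j' :=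
    fun _ _ _ _ _ _ _ _ _ => le_rfl
  -- the window bound in Markov form, threshold `η = 1`
  have hgen := measure_collisionSum_ge_le_liminf Φ P hstat hΔ F E hEm
    (fun M i' j' h => hEc M i' j' h) (fun _ => F) hFm hFt one_ne_zero ENNReal.one_ne_top
  -- (A) a contact of `{i, j}` in the slab makes the collision sum of the mark at least `1`
  have hsub : {z | z ∈ Φ.good ∧ ∃ u ∈ Icc 0 Δ,
      s(i, j) ∈ contactPairSet (Torus.geometry (Fin 3)) (hsDiameter σ N) (Φ.flow u z)} ⊆
      {z | z ∈ Φ.good ∧ (1 : ℝ≥0∞) ≤ ∑ᶠ s ∈ collisionTimes (Torus.geometry (Fin 3)) (hsDiameter σ N)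
          (fun t => Φ.flow t z) ∩ Icc 0 Δ,
        ∑ i', ∑ j', (if i' ≠ j' ∧ ‖(Torus.geometry (Fin 3)).sepVec (Φ.flow s z i').1
            (Φ.flow s z j').1‖ = hsDiameter σ N then F (Φ.flow s z) i' j' else 0)} := by
    rintro z ⟨hz, u, hu, hc⟩
    refine ⟨hz, ?_⟩
    obtain ⟨-, hc'⟩ := mem_contactPairSet.1 hc
    -- contact in either order is contact of the ordered pair `(i, j)`, and `u` is a collision time
    have hnorm : ‖(Torus.geometry (Fin 3)).sepVec (Φ.flow u z i).1 (Φ.flow u z j).1‖ =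
        hsDiameter σ N := by
      rcases hc' with h | h
      · exact (mem_contactSet.1 h).2
      · have h2 := (mem_contactSet.1 h).2
        rw [Torus.norm_geometry_sepVec, Torus.euclidDist_comm] at h2
        rw [Torus.norm_geometry_sepVec]
        exact h2
    have hcoll : u ∈ collisionTimes (Torus.geometry (Fin 3)) (hsDiameter σ N) (fun t => Φ.flow t z) := by
      rcases hc' with h | h
      · exact mem_collisionTimes.2 ⟨i, j, hij, h⟩
      · exact mem_collisionTimes.2 ⟨j, i, hij.symm, h⟩
    have hfin := (Φ.isTrajectory z hz).locFinite 0 Δ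
    rw [finsum_mem_eq_finite_toFinset_sum _ hfin]
    have hF1 : F (Φ.flow u z) i j = 1 := by simp [hFdef]
    have hterm : (1 : ℝ≥0∞) = (if i ≠ j ∧ ‖(Torus.geometry (Fin 3)).sepVec (Φ.flow u z i).1
        (Φ.flow u z j).1‖ = hsDiameter σ N then F (Φ.flow u z) i j else 0) := by
      rw [if_pos ⟨hij, hnorm⟩, hF1]
    calc (1 : ℝ≥0∞) = _ := hterm
      _ ≤ ∑ j', (if i ≠ j' ∧ ‖(Torus.geometry (Fin 3)).sepVec (Φ.flow u z i).1
            (Φ.flow u z j').1‖ = hsDiameter σ N then F (Φ.flow u z) i j' else 0) :=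
        Finset.single_le_sum_of_canonicallyOrdered (f := fun j' => (if i ≠ j' ∧
          ‖(Torus.geometry (Fin 3)).sepVec (Φ.flow u z i).1 (Φ.flow u z j').1‖ = hsDiameter σ N
            then F (Φ.flow u z) i j' else 0)) (Finset.mem_univ j)
      _ ≤ ∑ i', ∑ j', (if i' ≠ j' ∧ ‖(Torus.geometry (Fin 3)).sepVec (Φ.flow u z i').1
            (Φ.flow u z j').1‖ = hsDiameter σ N then F (Φ.flow u z) i' j' else 0) :=
        Finset.single_le_sum_of_canonicallyOrdered (f := fun i' => ∑ j', (if i' ≠ j' ∧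
          ‖(Torus.geometry (Fin 3)).sepVec (Φ.flow u z i').1 (Φ.flow u z j').1‖ = hsDiameter σ N
            then F (Φ.flow u z) i' j' else 0)) (Finset.mem_univ i)
      _ ≤ ∑ s ∈ hfin.toFinset, ∑ i', ∑ j', (if i' ≠ j' ∧
            ‖(Torus.geometry (Fin 3)).sepVec (Φ.flow s z i').1 (Φ.flow s z j').1‖ = hsDiameter σ N
              then F (Φ.flow s z) i' j' else 0) :=
        Finset.single_le_sum_of_canonicallyOrdered (f := fun s => ∑ i', ∑ j', (if i' ≠ j' ∧
          ‖(Torus.geometry (Fin 3)).sepVec (Φ.flow s z i').1 (Φ.flow s z j').1‖ = hsDiameter σ N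
            then F (Φ.flow s z) i' j' else 0)) (hfin.mem_toFinset.2 ⟨hcoll, hu⟩)
  -- (B) the one-window functional of the mark is the indicator of the window event of `(i, j)`
  have hW : ∀ (M : ℕ) (w : Config (N + 1) (Fin 3) T3),
      (∑ i', ∑ j', (if i' ≠ j' then (E M i' j').indicator (fun w => F w i' j') w else 0)) =
        (E M i j).indicator (fun _ => (1 : ℝ≥0∞)) w := by
    intro M w
    have hg : ∀ i' j' : Fin (N + 1), ¬ (i' = i ∧ j' = j) →
        (if i' ≠ j' then (E M i' j').indicator (fun w => F w i' j') w else 0) = 0 := by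
      intro i' j' hne
      by_cases h' : i' ≠ j'
      · rw [if_pos h']
        exact Set.indicator_apply_eq_zero.2 fun _ => if_neg hne
      · rw [if_neg h']
    calc (∑ i', ∑ j', (if i' ≠ j' then (E M i' j').indicator (fun w => F w i' j') w else 0))
        = ∑ j', (if i ≠ j' then (E M i j').indicator (fun w => F w i j') w else 0) :=
          Finset.sum_eq_single_of_mem i (Finset.mem_univ i)
            (fun i' _ hi' => Finset.sum_eq_zero fun j' _ => hg i' j' (fun h => hi' h.1))
      _ = (if i ≠ j then (E M i j).indicator (fun w => F w i j) w else 0) :=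
          Finset.sum_eq_single_of_mem j (Finset.mem_univ j)
            (fun j' _ hj' => hg i j' (fun h => hj' h.2))
      _ = (E M i j).indicator (fun _ => (1 : ℝ≥0∞)) w := by
          rw [if_pos hij]
          have hF1 : (fun w : Config (N + 1) (Fin 3) T3 => F w i j) = fun _ => 1 := by
            funext w'
            exact if_pos ⟨rfl, rfl⟩
          rw [hF1]
  -- (C) the mean of one window, times the number `M` of windows: the mesh cancels
  have hB : ∀ M : ℕ, (M : ℝ≥0∞) * ∫⁻ w, ∑ i', ∑ j',
      (if i' ≠ j' then (E M i' j').indicator (fun w => F w i' j') w else 0) ∂P ≤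
        5 * ENNReal.ofReal (4 * hsDiameter σ N ^ 2 * Δ) * I := by
    intro M
    rcases Nat.eq_zero_or_pos M with hM0 | hM0
    · subst hM0
      simp only [Nat.cast_zero, zero_mul, zero_le]
    have hM' : (0 : ℝ) < M := by exact_mod_cast hM0
    calc (M : ℝ≥0∞) * ∫⁻ w, ∑ i', ∑ j',
          (if i' ≠ j' then (E M i' j').indicator (fun w => F w i' j') w else 0) ∂P
        = (M : ℝ≥0∞) * ∫⁻ w, (E M i j).indicator (fun _ => (1 : ℝ≥0∞)) w ∂P := by
          congr 1
          exact lintegral_congr fun w => hW M w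
      _ ≤ (M : ℝ≥0∞) * (5 * ENNReal.ofReal (4 * hsDiameter σ N ^ 2 * (Δ / M)) * I) :=
          mul_le_mul' le_rfl (hEb M i j hij)
      _ = 5 * ENNReal.ofReal (4 * hsDiameter σ N ^ 2 * Δ) * I := by
          have h1 : (M : ℝ≥0∞) = ENNReal.ofReal (M : ℝ) := (ENNReal.ofReal_natCast M).symm
          have h3 : ENNReal.ofReal (M : ℝ) *
              (5 * ENNReal.ofReal (4 * hsDiameter σ N ^ 2 * (Δ / M)) * I) =
              5 * (ENNReal.ofReal (M : ℝ) * ENNReal.ofReal (4 * hsDiameter σ N ^ 2 * (Δ / M))) * I := by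
            ring
          have h4 : (M : ℝ) * (4 * hsDiameter σ N ^ 2 * (Δ / M)) = 4 * hsDiameter σ N ^ 2 * Δ := by
            field_simp
          rw [h1, h3, ← ENNReal.ofReal_mul (Nat.cast_nonneg _), h4]
  -- (D) assemble: Markov at `η = 1`, the liminf, the Gaussian flux integral
  have hsqrt : Real.sqrt (3 * θ) = Real.sqrt 3 * Real.sqrt θ := Real.sqrt_mul (by norm_num) θ
  calc P _ ≤ P _ := measure_mono hsub
    _ ≤ _ := hgen
    _ ≤ 1⁻¹ * (5 * ENNReal.ofReal (4 * hsDiameter σ N ^ 2 * Δ) * I) := by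
        gcongr
        exact liminf_le_of_frequently_le' (Frequently.of_forall hB)
    _ ≤ 1⁻¹ * (5 * ENNReal.ofReal (4 * hsDiameter σ N ^ 2 * Δ) *
          ENNReal.ofReal (2 * Real.sqrt (3 * θ))) := by
        gcongr
    _ = ENNReal.ofReal (40 * Real.sqrt 3 * (hsDiameter σ N ^ 2 * Real.sqrt θ * Δ)) := by
        rw [inv_one, one_mul, ← ENNReal.ofReal_ofNat 5, ← ENNReal.ofReal_mul (by norm_num),
          ← ENNReal.ofReal_mul (by positivity), hsqrt]
        congr 1
        ring

/-- ANCHOR (first moment, the `n = 1` instance of `X″`): PAIR SLAB-CONTACT BOUND. There is a universal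
constant `C ≥ 0` such that for `a, θ > 0`, `0 < σ ≤ 1/2`, every `N`, every flow, every pair `i ≠ j`, every
`t` and `Δ > 0`, the Gibbs probability that `i, j` are in contact at some time of `[t, t + Δ]` is at most
`C ε_N² √θ Δ` (collision-flux / Campbell bound in Markov form; Cercignani–Illner–Pulvirenti 1994 App. 4.A):
`C = 40 √3`; the slab `[t, t + Δ]` is transported to `[0, Δ]` by the group law of the flow on the good
set, the invariance `(Φ_t)_# G_N = G_N` and `G_N(goodᶜ) = 0`, and `measure_good_inter_pairContact_le`
concludes. [folklore] -/
theorem stub_pairSlabContact :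
    ∃ C : ℝ, 0 ≤ C ∧ ∀ a θ : ℝ, 0 < a → 0 < θ → ∀ σ : ℝ, 0 < σ → σ ≤ 1 / 2 → ∀ N : ℕ,
      ∀ Φ : HardSphereFlow (Torus.geometry (Fin 3)) (hsDiameter σ N) (N + 1),
      ∀ i j : Fin (N + 1), i ≠ j → ∀ t Δ : ℝ, 0 < Δ →
        localGibbsLaw σ (fun _ => a) (fun _ => 0) (fun _ => θ) N Φ
          {z | ∃ u ∈ Set.Icc t (t + Δ),
              s(i, j) ∈ contactPairSet (Torus.geometry (Fin 3)) (hsDiameter σ N) (Φ.flow u z)}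
          ≤ ENNReal.ofReal (C * (hsDiameter σ N ^ 2 * Real.sqrt θ * Δ)) := by
  refine ⟨40 * Real.sqrt 3, by positivity, ?_⟩
  intro a θ ha hθ σ hσ hσ2 N Φ i j hij t Δ hΔ
  set P := localGibbsLaw σ (fun _ => a) (fun _ => (0 : V3)) (fun _ => θ) N Φ with hPdef
  -- the Gibbs law is carried by the good set
  have hP : P Φ.goodᶜ = 0 := by
    rw [hPdef, localGibbsLaw_eq]
    exact localGibbsMeasure_absolutelyContinuous σ _ _ _ N Φ Φ.measure_compl_good
  -- the event of the slab `[0, Δ]` on the good set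
  set B : Set (Config (N + 1) (Fin 3) T3) := {w | w ∈ Φ.good ∧ ∃ u ∈ Icc 0 Δ,
    s(i, j) ∈ contactPairSet (Torus.geometry (Fin 3)) (hsDiameter σ N) (Φ.flow u w)} with hBdef
  -- transport by `Φ_t`: `Φ_u z = Φ_{u - t} (Φ_t z)` on the good set
  have hsub : {z | ∃ u ∈ Set.Icc t (t + Δ),
      s(i, j) ∈ contactPairSet (Torus.geometry (Fin 3)) (hsDiameter σ N) (Φ.flow u z)} ⊆
      (Φ.flow t) ⁻¹' B ∪ Φ.goodᶜ := by
    intro z hz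
    by_cases hg : z ∈ Φ.good
    · left
      obtain ⟨u, hu, hc⟩ := hz
      have hflow : Φ.flow (u - t) (Φ.flow t z) = Φ.flow u z := by
        rw [← Φ.flow_add (u - t) t z hg, sub_add_cancel]
      refine ⟨Φ.mapsTo_good t hg, u - t, ⟨by linarith [hu.1], by linarith [hu.2]⟩, ?_⟩
      rw [hflow]
      exact hc
    · right
      exact hg
  calc P _ ≤ P ((Φ.flow t) ⁻¹' B ∪ Φ.goodᶜ) := measure_mono hsub
    _ ≤ P ((Φ.flow t) ⁻¹' B) + P Φ.goodᶜ := measure_union_le _ _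
    _ = P ((Φ.flow t) ⁻¹' B) := by rw [hP, add_zero]
    _ ≤ (P.map (Φ.flow t)) B := Measure.le_map_apply (Φ.measurable_flow t).aemeasurable B
    _ = P B := by rw [(measurePreserving_flow_localGibbsLaw_const σ a θ 0 N Φ t).map_eq]
    _ ≤ ENNReal.ofReal (40 * Real.sqrt 3 * (hsDiameter σ N ^ 2 * Real.sqrt θ * Δ)) :=
        measure_good_inter_pairContact_le ha hθ hσ hσ2 Φ hij hΔ

end Summit.AtomisticToContinuum.HydrodynamicLimit.Theorems.LogWindowTaggedTail

end
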